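import Literature.MathematicalPhysics.QuantumFieldTheory.Balaban1983to89.B9Eq326GaugeTermSquareZd

/-!
# `Balaban1983to89.B9Eq327GreenZd` — [Balaban1985BackgroundPropagators] (3.27) p. 395 «G(U) = G = (Δ_a↾Ω₀)⁻¹» AT THE `ℤᵈ × 𝔸` CARRIERS:
# the propagator letter `Gop` of the J-N06→N05 junction record `B9SupplySockB9P3ZdLetters.OpsZd` made a GENUINE OBJECT — the inverse of the
# Dirichlet operator `𝟙_{Ω₀}Δ_a(U₀)𝟙_{Ω₀}` on the field class `E(Ω₀)` whenever it is invertible (Theorem 3.11's regime), for ANY co-letters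
# `Δ′ ∕ D R D* ∕ Q*aQ` of the record —; the binder `GopAddAt` PROVED for it outright and the binder `InvAt` REDUCED to ONE displayed hypothesis:
# Theorem 3.11 AT THE MEMBER («`Δ_a(U₀)↾Ω₀` invertible on `E(Ω₀)` in the class (3.35)»), which for finite `Ω₀` follows from the POSITIVITY of `⟨A, Δ_a(U₀)A⟩`

statement-level skeleton of published theorems with citation tags; proofs where landed; nothing here is a claim about the
Yang–Mills mass gap

`[Balaban1985BackgroundPropagators]` ("B9", CMP **99** (1985) 389–434) p. 395: *«Finally let us define the most important operator
Δ^η_a(U) = Δ^η(U) + D^η_U R(U) D^{η*}_U + Q*(U)aQ(U), (3.26) and G(U) = G = (Δ_a↾Ω₀)⁻¹ = (Ω₀Δ_aΩ₀)⁻¹ (3.27), where Ω₀ denotes also the characteristic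
function of the set Ω₀.»*; p. 394 (after (3.25)): *«We do not know yet if the operators in the above formulas are well defined … It will be proved later
(Theorem 3.11) with the restrictions on U described below.»*; p. 416, Theorem 3.11: *«There exist constants M₀, α₀′ > 0 such that for M ≥ M₀, α₀ ≤ α₀′ and
for U satisfying (3.35) the operators Δ′_a, G′, (Q′G′²Q′*)⁻¹, Δ_a, G are positive definite … uniformly in U, Ω_j.»*  `[Balaban1985RegularSpaces]` ("B8")
p. 86 (1.58): *«A = G(U₀)J − … where the operator G(U₀) was introduced and investigated in [4]»*; p. 77 (bond convention: «at least one end-point of b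
belongs to Ω»).  PDF held: `paper:balaban1985-cmp99-background-propagators` pp. 394–395, 416 (re-read by this seat, 2026-08-28).

CITATION HEADER (lean-in-tree rule).  Cell `pub-ymgap` (YM Track A, HUMAN RULING D-0062 ∕ D-0149 width push), DAG node N06 = [B9], width seat
`pub-ymgap-dag-n06-w4` (g2), `W-SEAT-START-LIST` v8 § n06 ITEM 4 «(γ) Thm 3.3 at a curved U₀ at the carrier: the letters G(U₀), Δ′(U₀), R(U₀), Q*ⱼ AS
OPERATORS + the binders»; successor pointer (a) of this seat's g0 HANDOFF and dag-n06-b g16's DESIGN ANSWER (γ) («`Gop`-as-inverse = Thm 3.11 regime»).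
The junction's operator layer is the PARAMETER RECORD `OpsZd` (`Gop ∕ Dp ∕ DRDs ∕ QQ` — «LETTERS, NOT OBJECTS»); two letters are objects already, by
RECORD EDITS of one field each: `Dp` (dag-n06-w2's `withDpZd`, the genuine Δ′ of (3.10), p586146) and `DRDs` (this seat's `opsLandau τ`, the genuine
`D R(U₀) 𝟙_{Ω₀}D*` of (3.20)–(3.26), p585863).  THIS FILE is the third record edit, `withGopZd`: the field `Gop` becomes print's `G(U₀) = (Ω₀Δ_aΩ₀)⁻¹`
built from WHATEVER co-letters the record carries (`deltaAOf` = `D*D + Dp + DRDs + QQ`) — so it composes with the other two edits by `rfl` —, and the two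
`Gop`-binders of `B9SupplySockB9P3ZdAt` not involving the norm dictionary are settled: `GopAddAt` is a THEOREM; `InvAt` holds under `RegularInClassAt` =
Theorem 3.11 at the member (NOT proved: N06's object-bound; §4 turns positivity into invertibility on the finite-dimensional `E(Ω₀)`; §5 inhabits it).

WHAT IS DECLARED ∕ PROVED (kernel, 0 sorry; definitions with bodies + theorems; no `instance`, no `notation`).
* §1 `domSub Ω₀` = `E(Ω₀)` AS A CARRIER (the real subspace of bond fields vanishing off the bonds with an end-point in `Ω₀`; the first clause of
  `B9SupplySockB9P3ZdLettersOmega.OnDom`), `restrictLin Ω₀` (`𝟙_{Ω₀}` as a linear map into it), `setOf_bondTouches_finite`, `finiteDimensional_domSub`.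
* §2 `deltaADom η o Ω₀ U₀` («Δ_a↾Ω₀», for ANY letter record `o : OpsZd`); ★ `RegularAt η o Ω₀ U₀` («`Δ_a(U₀)↾Ω₀` agrees on `E(Ω₀)` with an INVERTIBLE
  ℝ-linear operator» — Theorem 3.11's conclusion at one background, qualitative); ★ `gopZd η o Ω₀ U₀ J` = **`G(U₀)J := (Ω₀Δ_aΩ₀)⁻¹(𝟙_{Ω₀}J)`** when
  `RegularAt`, `0` otherwise; `gopZd_add ∕ _mem_domSub`; ★★ `gopZd_apply_eq_of_regularAt` (`G(U₀)J = A` for `A ∈ E(Ω₀)`,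
  `J = Δ_a(U₀)A` on the `Ω₀`-bonds).
* §3 `withGopZd ops` (`withGopZd_Gop ∕ _Dp ∕ _DRDs ∕ _QQ`, `deltaAOf_withGopZd` — `rfl`); ★★ `gopAddAt_withGopZd` — `GopAddAt L (withGopZd ops) M i m` at
  EVERY member, NO hypothesis; `RegularInClassAt bg mem ιCfg ops c35 a₃ M i m` (Theorem 3.11 at the member: `RegularAt` at every unitary `U₀` of the
  member's (3.35) class with `Mα₀ ≤ a₃` — the guards of `InvAt` verbatim); ★★★ `invAt_withGopZd` — `InvAt bg L mem ιCfg (withGopZd ops) c35 a₃ M i m`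
  from `RegularInClassAt` ALONE.
* §4 (finite `Ω₀`, finite-dimensional `𝔸`, trace PARAMETER `τ`) `bondPair τ A J = Σ_μ Σᶠ_x Re τ(A(x,μ)* J(x,μ))`, `LinearOnDomAt η o Ω₀ U₀` («`Δ_a(U₀)` is
  ℝ-linear on `E(Ω₀)`»); ★★ `regularAt_of_bondPair_pos` — LINEARITY + `0 < ⟨A, Δ_a(U₀)A⟩_τ` for `0 ≠ A ∈ E(Ω₀)` ⟹ `RegularAt` (positive ⟹ injective ⟹
  bijective); `bondPair_deltaAOf_eq_four_terms` (`⟨A,Δ_aA⟩ = ⟨A,D*DA⟩ + ⟨A,Δ′A⟩ + ⟨A,DRD*A⟩ + ⟨A,Q*aQA⟩`; the first `≥ 0` by `sum_finsum_re_trace_Jcur_nonneg`,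
  the third for `opsLandau τ` by `opsLandau_DRDs_form_nonneg`, p591149).
* §5 A6 ∕ NON-VACUITY: `opsLevelZero ops₀` (`Dp := 0`, `DRDs := 0`, `QQ := η⁻²·𝟙_{Ω₀}` — the ONE-LEVEL reading of (3.16): `m = 0`, `Q₀ = I`, `Λ₀ = Ω₀`);
  `Jcur_smul ∕ Jcur_smul_real`, `deltaALevelZeroLin`, ★ `bondPair_deltaAOf_opsLevelZero_pos` (`⟨A,Δ_aA⟩ = ⟨A,D*DA⟩ + η⁻²‖A‖²_τ > 0`, EVERY unitary
  `U₀`), ★ `regularAt_opsLevelZero`, `regularInClassAt_opsLevelZero`, `invAt_withGopZd_opsLevelZero` —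
  the hypothesis of §3 and its conclusion are inhabited at every member with finite `Ω₀` (an inhabitant of the HYPOTHESIS CLASS, not print's regime).

HONEST SCOPE.  (i) ONE letter (`Gop`) is made an object; `GopAddAt` PROVED, `InvAt` ⟸ `RegularInClassAt` (Theorem 3.11 at the member — NOT proved: the
positivity of `Δ_a(U₀)` at curved `U₀` in the class (3.35) is [4] Sect. E, N06's object-bound).  `AvgAt` (needs the transpose stencil of `linCovIter`),
`HolderAt` ∕ `SrcAt` ∕ `SrcHolderAt` ∕ `DictAt` (Theorem 3.3's estimates, the norm dictionary) are untouched.  (ii) READING: `E(Ω₀)` = bond fields on `ℤᵈ`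
vanishing off the bonds with an end-point in `Ω₀` (B8 p. 77); `G(U₀)J` reads `J` through `𝟙_{Ω₀}J`; «invertible» = bijective ℝ-linear on `E(Ω₀)`
(finite `Ω₀`: = injective ⟸ positive pairing, §4); outside the regime the letter is `0` (no binder reads `Gop` there except `GopAddAt`, which holds).
(iii) `τ` is a PARAMETER with displayed properties (tracial, faithful), as in this seat's Landau files; no instance.  (iv) Count-neutral; N05 ∕ N06 NOT
discharged; K1⁷ `stmt-QuantumFields-20542` NOT closed; one finite `𝕋⁴` programme at fixed `ε`, Bałaban as printed; R4 closes only the conditional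
finite-`𝕋⁴` rung `BalabanLadder.UV` — nothing continuum ∕ ℝ⁴ ∕ OS ∕ mass gap ∕ Clay.  Unit `pub-ymgap-dag-n06-w4` (g2), 2026-08-28.
-/

noncomputable section

namespace Literature.MathematicalPhysics.QuantumFieldTheory.Balaban1983to89.B9Eq327GreenZd

open B7Prop1Explicit B7Eq78Linearization
open B7Prop2Explicit (unitaryUnits)
open B8Ineq132 (BondTouches)
open B8Eq155JBound (Jcur)
open B8Eq146AExpansion (plaqCovDeriv)
open B8LeafModelZd (ZdIdx)
open B9SupplySockB9P3ZdLetters (OpsZd deltaAOf)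
open B9SupplySockB9P3ZdLettersOmega (OnDom restrictDom restrictDom_of restrictDom_of_not)
open B9SupplySockB9P3ZdAt (InvAt GopAddAt)
open B9Eq321LandauProjectionZd (opsLandau)
open B9Eq326GaugeTermSquareZd (sum_finsum_re_trace_Jcur_nonneg opsLandau_DRDs_form_nonneg)

-- `Site` alone could resolve to the torus sites of `Setup.lean`; re-export the `ℤ^d` sites of `B7Prop1Explicit`.
export B7Prop1Explicit (Site)

variable {d : ℕ} {𝔸 : Type*} [CStarAlgebra 𝔸]

/-! ## §1  The field class `E(Ω₀)` as a carrier: bond fields vanishing off the bonds with an end-point in `Ω₀` -/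

section Carrier

variable (Ω₀ : Set (Site d))

/-- **THE FIELD CLASS `E(Ω₀)` AS A REAL SUBSPACE**: bond fields `ℤᵈ × {directions} → 𝔸` vanishing at every bond `⟨y, y + e_τ⟩` with no end-point in
`Ω₀` — the Dirichlet reading «Ω₀Δ_aΩ₀» of (3.27) with B8's bond convention (the first clause of `B9SupplySockB9P3ZdLettersOmega.OnDom`).
[cite: Balaban1985BackgroundPropagators, (3.27) p.395; Balaban1985RegularSpaces, p.77 (bond convention)] -/
def domSub : Submodule ℝ (Site d → Fin d → 𝔸) where
  carrier := {A | ∀ (y : Site d) (τ : Fin d), ¬ BondTouches Ω₀ y τ → A y τ = 0}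
  add_mem' := by
    intro A B hA hB y τ h
    rw [Pi.add_apply, Pi.add_apply, hA y τ h, hB y τ h, add_zero]
  zero_mem' := fun _ _ _ => rfl
  smul_mem' := by
    intro c A hA y τ h
    rw [Pi.smul_apply, Pi.smul_apply, hA y τ h, smul_zero]

/-- the first clause of `OnDom` IS membership in `E(Ω₀)`. [cite: Balaban1985BackgroundPropagators, (3.27) p.395 (bookkeeping)] -/
theorem mem_domSub_of_onDom {L m : ℕ} {η : ℝ} {Ω : ℕ → Set (Site d)} {A : Site d → Fin d → 𝔸} (hA : OnDom L m η Ω A) :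
    A ∈ domSub (𝔸 := 𝔸) (Ω 0) := hA.1

/-- **`𝟙_{Ω₀}J ∈ E(Ω₀)`** for every bond field `J`. [cite: Balaban1985BackgroundPropagators, (3.27) p.395 («Ω₀ denotes also the characteristic function»)] -/
theorem restrictDom_mem_domSub (J : Site d → Fin d → 𝔸) : restrictDom Ω₀ J ∈ domSub (𝔸 := 𝔸) Ω₀ :=
  fun _ _ h => restrictDom_of_not J h

/-- `𝟙_{Ω₀}A = A` for `A ∈ E(Ω₀)`. [cite: Balaban1985BackgroundPropagators, (3.27) p.395 (bookkeeping)] -/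
theorem restrictDom_eq_self_of_mem {A : Site d → Fin d → 𝔸} (hA : A ∈ domSub (𝔸 := 𝔸) Ω₀) : restrictDom Ω₀ A = A := by
  funext y τ
  by_cases h : BondTouches Ω₀ y τ
  · exact restrictDom_of A h
  · rw [restrictDom_of_not A h, hA y τ h]

/-- `𝟙_{Ω₀}` is additive. [cite: Balaban1985BackgroundPropagators, (3.27) p.395 (bookkeeping)] -/
theorem restrictDom_add' (J₁ J₂ : Site d → Fin d → 𝔸) : restrictDom Ω₀ (J₁ + J₂) = restrictDom Ω₀ J₁ + restrictDom Ω₀ J₂ := by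
  funext y τ
  by_cases h : BondTouches Ω₀ y τ
  · rw [Pi.add_apply, Pi.add_apply, restrictDom_of _ h, restrictDom_of _ h, restrictDom_of _ h, Pi.add_apply, Pi.add_apply]
  · rw [Pi.add_apply, Pi.add_apply, restrictDom_of_not _ h, restrictDom_of_not _ h, restrictDom_of_not _ h, add_zero]

/-- `𝟙_{Ω₀}` is ℝ-homogeneous. [cite: Balaban1985BackgroundPropagators, (3.27) p.395 (bookkeeping)] -/
theorem restrictDom_smul' (c : ℝ) (J : Site d → Fin d → 𝔸) : restrictDom Ω₀ (c • J) = c • restrictDom Ω₀ J := by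
  funext y τ
  by_cases h : BondTouches Ω₀ y τ
  · rw [Pi.smul_apply, Pi.smul_apply, restrictDom_of _ h, restrictDom_of _ h, Pi.smul_apply, Pi.smul_apply]
  · rw [Pi.smul_apply, Pi.smul_apply, restrictDom_of_not _ h, restrictDom_of_not _ h, smul_zero]

/-- **`𝟙_{Ω₀}` AS A LINEAR MAP INTO `E(Ω₀)`.** [cite: Balaban1985BackgroundPropagators, (3.27) p.395 («Ω₀ denotes also the characteristic function»)] -/
def restrictLin : (Site d → Fin d → 𝔸) →ₗ[ℝ] domSub (𝔸 := 𝔸) Ω₀ where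
  toFun J := ⟨restrictDom Ω₀ J, restrictDom_mem_domSub Ω₀ J⟩
  map_add' J₁ J₂ := Subtype.ext (restrictDom_add' Ω₀ J₁ J₂)
  map_smul' c J := Subtype.ext (restrictDom_smul' Ω₀ c J)

/-- `restrictLin`, unfolded. [cite: Balaban1985BackgroundPropagators, (3.27) p.395 (bookkeeping)] -/
theorem restrictLin_coe (J : Site d → Fin d → 𝔸) : (restrictLin (𝔸 := 𝔸) Ω₀ J : Site d → Fin d → 𝔸) = restrictDom Ω₀ J := rfl

omit [CStarAlgebra 𝔸] in
/-- **A FINITE `Ω₀` HAS FINITELY MANY BONDS** (each bond with an end-point in `Ω₀` is `⟨y, y + e_τ⟩` with `y ∈ Ω₀` or `y + e_τ ∈ Ω₀`).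
[cite: Balaban1985RegularSpaces, p.77 (bond convention)] -/
theorem setOf_bondTouches_finite {Ω₀ : Set (Site d)} (hΩ : Ω₀.Finite) : {b : Site d × Fin d | BondTouches Ω₀ b.1 b.2}.Finite := by
  have h1 : (Ω₀ ×ˢ (Set.univ : Set (Fin d))).Finite := hΩ.prod Set.finite_univ
  have h2 : ((fun p : Site d × Fin d => (p.1 - e p.2, p.2)) '' (Ω₀ ×ˢ (Set.univ : Set (Fin d)))).Finite := h1.image _
  refine (h1.union h2).subset fun b hb => ?_
  rcases hb with hb | hb
  · exact Or.inl ⟨hb, Set.mem_univ _⟩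
  · refine Or.inr ⟨(b.1 + e b.2, b.2), ⟨hb, Set.mem_univ _⟩, ?_⟩
    simp only [add_sub_cancel_right, Prod.mk.eta]

/-- **`E(Ω₀)` IS FINITE-DIMENSIONAL** over `ℝ` for a finite `Ω₀` and a finite-dimensional fibre (restriction to the finitely many bonds of `Ω₀` is
injective). [cite: Balaban1985BackgroundPropagators, (3.27) p.395 («(Ω₀Δ_aΩ₀)⁻¹» — a finite matrix for finite Ω₀)] -/
theorem finiteDimensional_domSub [FiniteDimensional ℝ 𝔸] {Ω₀ : Set (Site d)} (hΩ : Ω₀.Finite) :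
    FiniteDimensional ℝ (domSub (𝔸 := 𝔸) Ω₀) := by
  haveI : Finite (↥{b : Site d × Fin d | BondTouches Ω₀ b.1 b.2}) := (setOf_bondTouches_finite hΩ).to_subtype
  let res : domSub (𝔸 := 𝔸) Ω₀ →ₗ[ℝ] (↥{b : Site d × Fin d | BondTouches Ω₀ b.1 b.2} → 𝔸) :=
    { toFun := fun A b => (A : Site d → Fin d → 𝔸) b.1.1 b.1.2
      map_add' := fun A B => rfl
      map_smul' := fun c A => rfl }
  refine FiniteDimensional.of_injective res fun A B h => ?_
  apply Subtype.ext
  funext y τ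
  by_cases hb : BondTouches Ω₀ y τ
  · exact congr_fun h ⟨(y, τ), hb⟩
  · rw [A.2 y τ hb, B.2 y τ hb]

end Carrier

/-! ## §2  `Δ_a↾Ω₀`, the regularity predicate (Theorem 3.11's conclusion), and `G(U₀) = (Ω₀Δ_aΩ₀)⁻¹` -/

section Green

variable (η : ℝ) (o : OpsZd d 𝔸) (Ω₀ : Set (Site d)) (U₀ : Site d → Fin d → 𝔸ˣ)

/-- **«Δ_a↾Ω₀ = Ω₀Δ_aΩ₀»** on bond fields: `Δ_a(U₀)A = D*_{U₀}D_{U₀}A + Δ′A + DRD*A + Q*aQA` (`deltaAOf`, (3.26) with (3.10), read with the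
record's letters `o.Dp ∕ o.DRDs ∕ o.QQ`) followed by the restriction `𝟙_{Ω₀}` to the bonds of `Ω₀` (Dirichlet).
[cite: Balaban1985BackgroundPropagators, (3.26)–(3.27) p.395] -/
def deltaADom (A : Site d → Fin d → 𝔸) : Site d → Fin d → 𝔸 := restrictDom Ω₀ (deltaAOf η o U₀ A)

/-- `Δ_a↾Ω₀`, unfolded at a bond. [cite: Balaban1985BackgroundPropagators, (3.27) p.395 (bookkeeping)] -/
theorem deltaADom_apply (A : Site d → Fin d → 𝔸) (y : Site d) (τ : Fin d) :
    deltaADom η o Ω₀ U₀ A y τ = restrictDom Ω₀ (deltaAOf η o U₀ A) y τ := rfl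

/-- ★ **THE REGULARITY PREDICATE AT ONE BACKGROUND** — Theorem 3.11's conclusion for `Δ_a`, `G` in its qualitative form: «`Δ_a(U₀)↾Ω₀` agrees on
`E(Ω₀)` with an INVERTIBLE ℝ-linear operator of `E(Ω₀)`» (so that `G(U₀) = (Ω₀Δ_aΩ₀)⁻¹` of (3.27) exists).  NOT asserted — a `Prop` the consumer
supplies (print: «It will be proved later (Theorem 3.11) with the restrictions on U described below»).
[cite: Balaban1985BackgroundPropagators, p.394 (after (3.25)), Thm 3.11 p.416, (3.27) p.395] -/
def RegularAt (η : ℝ) (o : OpsZd d 𝔸) (Ω₀ : Set (Site d)) (U₀ : Site d → Fin d → 𝔸ˣ) : Prop :=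
  ∃ Φ : domSub (𝔸 := 𝔸) Ω₀ →ₗ[ℝ] domSub (𝔸 := 𝔸) Ω₀,
    (∀ A : domSub (𝔸 := 𝔸) Ω₀, (Φ A : Site d → Fin d → 𝔸) = deltaADom η o Ω₀ U₀ A) ∧ Function.Bijective Φ

/-- the invertible operator of `RegularAt`, as a linear equivalence of `E(Ω₀)`. [cite: Balaban1985BackgroundPropagators, (3.27) p.395] -/
def deltaAEquiv (h : RegularAt η o Ω₀ U₀) : domSub (𝔸 := 𝔸) Ω₀ ≃ₗ[ℝ] domSub (𝔸 := 𝔸) Ω₀ :=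
  LinearEquiv.ofBijective (Classical.choose h) (Classical.choose_spec h).2

/-- the equivalence acts as `Δ_a↾Ω₀`. [cite: Balaban1985BackgroundPropagators, (3.27) p.395 (bookkeeping)] -/
theorem deltaAEquiv_coe (h : RegularAt η o Ω₀ U₀) (A : domSub (𝔸 := 𝔸) Ω₀) :
    (deltaAEquiv η o Ω₀ U₀ h A : Site d → Fin d → 𝔸) = deltaADom η o Ω₀ U₀ A := by
  rw [deltaAEquiv, LinearEquiv.ofBijective_apply]
  exact (Classical.choose_spec h).1 A

open Classical in
/-- ★ **`G(U₀) = (Ω₀Δ_aΩ₀)⁻¹`, THE PROPAGATOR LETTER AS AN OBJECT** ((3.27)): on a bond field `J`, restrict to the bonds of `Ω₀` and apply the inverse of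
the invertible operator `Δ_a(U₀)↾Ω₀` of `E(Ω₀)` — when `RegularAt` (Theorem 3.11's regime); `0` otherwise (no claim there).  Built from WHATEVER co-letters
`Dp ∕ DRDs ∕ QQ` the record `o` carries. [cite: Balaban1985BackgroundPropagators, (3.27) p.395, Thm 3.11 p.416; Balaban1985RegularSpaces, (1.58) p.86] -/
def gopZd (J : Site d → Fin d → 𝔸) : Site d → Fin d → 𝔸 :=
  if h : RegularAt η o Ω₀ U₀ then ((deltaAEquiv η o Ω₀ U₀ h).symm (restrictLin Ω₀ J) : domSub (𝔸 := 𝔸) Ω₀) else 0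

/-- `G(U₀)` in the regime: the inverse applied to `𝟙_{Ω₀}J`. [cite: Balaban1985BackgroundPropagators, (3.27) p.395 (bookkeeping)] -/
theorem gopZd_of_regularAt (h : RegularAt η o Ω₀ U₀) (J : Site d → Fin d → 𝔸) :
    gopZd η o Ω₀ U₀ J = ((deltaAEquiv η o Ω₀ U₀ h).symm (restrictLin Ω₀ J) : domSub (𝔸 := 𝔸) Ω₀) := by
  rw [gopZd, dif_pos h]

/-- `G(U₀) = 0` outside the regime (no claim). [cite: Balaban1985BackgroundPropagators, (3.27) p.395 (bookkeeping)] -/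
theorem gopZd_of_not_regularAt (h : ¬ RegularAt η o Ω₀ U₀) (J : Site d → Fin d → 𝔸) : gopZd η o Ω₀ U₀ J = 0 := by
  rw [gopZd, dif_neg h]

/-- **`G(U₀)` IS ADDITIVE IN `J`, ALWAYS** (a linear inverse composed with `𝟙_{Ω₀}` in the regime, `0` outside).
[cite: Balaban1985BackgroundPropagators, (3.27) p.395] -/
theorem gopZd_add (J₁ J₂ : Site d → Fin d → 𝔸) : gopZd η o Ω₀ U₀ (J₁ + J₂) = gopZd η o Ω₀ U₀ J₁ + gopZd η o Ω₀ U₀ J₂ := by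
  by_cases h : RegularAt η o Ω₀ U₀
  · rw [gopZd_of_regularAt η o Ω₀ U₀ h, gopZd_of_regularAt η o Ω₀ U₀ h, gopZd_of_regularAt η o Ω₀ U₀ h, map_add, map_add,
      Submodule.coe_add]
  · rw [gopZd_of_not_regularAt η o Ω₀ U₀ h, gopZd_of_not_regularAt η o Ω₀ U₀ h, gopZd_of_not_regularAt η o Ω₀ U₀ h, add_zero]

/-- `G(U₀)J ∈ E(Ω₀)` (Dirichlet: the propagator's output lives on the bonds of `Ω₀`). [cite: Balaban1985BackgroundPropagators, (3.27) p.395 («(Ω₀Δ_aΩ₀)⁻¹»)] -/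
theorem gopZd_mem_domSub (J : Site d → Fin d → 𝔸) : gopZd η o Ω₀ U₀ J ∈ domSub (𝔸 := 𝔸) Ω₀ := by
  by_cases h : RegularAt η o Ω₀ U₀
  · rw [gopZd_of_regularAt η o Ω₀ U₀ h]
    exact Submodule.coe_mem _
  · rw [gopZd_of_not_regularAt η o Ω₀ U₀ h]
    exact Submodule.zero_mem _

/-- ★★ **(3.27) AS B8 (1.58) USES IT: `G(U₀)(Δ_a(U₀)A) = A` ON `E(Ω₀)`** — in Theorem 3.11's regime (`RegularAt`), for `A ∈ E(Ω₀)` and ANY bond field `J`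
agreeing with `Δ_a(U₀)A` on the bonds of `Ω₀`, `G(U₀)J = A`. [cite: Balaban1985BackgroundPropagators, (3.27) p.395; Balaban1985RegularSpaces, (1.58) p.86] -/
theorem gopZd_apply_eq_of_regularAt (h : RegularAt η o Ω₀ U₀) {A : Site d → Fin d → 𝔸} (hA : A ∈ domSub (𝔸 := 𝔸) Ω₀)
    {J : Site d → Fin d → 𝔸} (hJ : ∀ (y : Site d) (τ : Fin d), BondTouches Ω₀ y τ → J y τ = deltaAOf η o U₀ A y τ) :
    gopZd η o Ω₀ U₀ J = A := by
  rw [gopZd_of_regularAt η o Ω₀ U₀ h]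
  -- `𝟙_{Ω₀}J = (Δ_a↾Ω₀)A = Φ ⟨A, hA⟩`
  have hres : restrictLin (𝔸 := 𝔸) Ω₀ J = deltaAEquiv η o Ω₀ U₀ h ⟨A, hA⟩ := by
    apply Subtype.ext
    rw [restrictLin_coe, deltaAEquiv_coe]
    funext y τ
    by_cases hb : BondTouches Ω₀ y τ
    · rw [restrictDom_of J hb, deltaADom_apply, restrictDom_of _ hb, hJ y τ hb]
    · rw [restrictDom_of_not J hb, deltaADom_apply, restrictDom_of_not _ hb]
  rw [hres, LinearEquiv.symm_apply_apply]

end Green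

/-! ## §3  The record edit `withGopZd`; the binders `GopAddAt` (proved) and `InvAt` (from Theorem 3.11 at the member) -/

section Record

variable {L : ℕ}

/-- **THE LETTER FAMILY WITH A GENUINE `G(U₀)`**: `ops` with its `Gop` field replaced, at every member `(M, i, m)`, by `gopZd i.η (ops M i m) (i.Ω 0)` —
print's `(Ω₀Δ_aΩ₀)⁻¹` for the member's `Ω₀ = i.Ω 0`, `η = i.η` and the record's OWN co-letters `Dp ∕ DRDs ∕ QQ` (untouched).
[cite: Balaban1985BackgroundPropagators, (3.27) p.395, (3.26) p.395] -/
def withGopZd (ops : ℝ → ZdIdx d L → ℕ → OpsZd d 𝔸) : ℝ → ZdIdx d L → ℕ → OpsZd d 𝔸 :=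
  fun M i m => { ops M i m with Gop := fun U₀ J => gopZd i.η (ops M i m) (i.Ω 0) U₀ J }

variable (ops : ℝ → ZdIdx d L → ℕ → OpsZd d 𝔸) (M : ℝ) (i : ZdIdx d L) (m : ℕ)

/-- the `Gop` field of `withGopZd ops`, unfolded. [cite: Balaban1985BackgroundPropagators, (3.27) p.395 (bookkeeping)] -/
theorem withGopZd_Gop (U₀ : Site d → Fin d → 𝔸ˣ) (J : Site d → Fin d → 𝔸) :
    (withGopZd ops M i m).Gop U₀ J = gopZd i.η (ops M i m) (i.Ω 0) U₀ J := rfl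

/-- the `Dp` field is untouched. [cite: Balaban1985BackgroundPropagators, (3.10) p.392] -/
theorem withGopZd_Dp : (withGopZd ops M i m).Dp = (ops M i m).Dp := rfl

/-- the `DRDs` field is untouched. [cite: Balaban1985BackgroundPropagators, (3.26) p.395] -/
theorem withGopZd_DRDs : (withGopZd ops M i m).DRDs = (ops M i m).DRDs := rfl

/-- the `QQ` field is untouched. [cite: Balaban1985BackgroundPropagators, (3.16) p.393] -/
theorem withGopZd_QQ : (withGopZd ops M i m).QQ = (ops M i m).QQ := rfl

/-- `Δ_a` of the edited record is `Δ_a` of the record (it never reads `Gop`). [cite: Balaban1985BackgroundPropagators, (3.26) p.395] -/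
theorem deltaAOf_withGopZd (U₀ : Site d → Fin d → 𝔸ˣ) (A : Site d → Fin d → 𝔸) :
    deltaAOf i.η (withGopZd ops M i m) U₀ A = deltaAOf i.η (ops M i m) U₀ A := rfl

/-- ★★ **THE BINDER `GopAddAt` HOLDS FOR THE GENUINE LETTER AT EVERY MEMBER, WITH NO HYPOTHESIS** — `G(U₀)(J₁ + J₂) = G(U₀)J₁ + G(U₀)J₂` for every
background and all bond fields. [cite: Balaban1985BackgroundPropagators, (3.27) p.395] -/
theorem gopAddAt_withGopZd : GopAddAt L (withGopZd ops) M i m := by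
  intro U₀ J₁ J₂
  exact gopZd_add i.η (ops M i m) (i.Ω 0) U₀ J₁ J₂

variable {I : Type} (bg : I → B9.Backgrounds) (mem : ℝ → ZdIdx d L → ℕ → I)
variable (ιCfg : ∀ (M : ℝ) (i : ZdIdx d L) (m : ℕ) (U₀ : Site d → Fin d → 𝔸ˣ),
  (∀ x κ, U₀ x κ ∈ unitaryUnits 𝔸) → (bg (mem M i m)).Cfg)

/-- **THEOREM 3.11 AT THE MEMBER `(M, i, m)`** (qualitative form, for the record's `Δ_a`): at every unitary background `U₀` of the member's regularity
class (3.35) with `0 < α₀`, `Mα₀ ≤ a₃` — the guards of `B9SupplySockB9P3ZdAt.InvAt` verbatim — `Δ_a(U₀)↾Ω₀` is invertible on `E(Ω₀)` (`RegularAt`).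
A `Prop` the consumer supplies; print's Theorem 3.11 («for M ≥ M₀, α₀ ≤ α₀′ and for U satisfying (3.35) the operators … Δ_a, G are positive definite»)
is its content — NOT proved here. [cite: Balaban1985BackgroundPropagators, Thm 3.11 p.416, (3.35) p.396, (3.27) p.395] -/
def RegularInClassAt (ops : ℝ → ZdIdx d L → ℕ → OpsZd d 𝔸) (c35 a₃ : ℝ) (M : ℝ) (i : ZdIdx d L) (m : ℕ) : Prop :=
  ∀ (α₀ : ℝ) (U₀ : Site d → Fin d → 𝔸ˣ) (hU₀ : ∀ x κ, U₀ x κ ∈ unitaryUnits 𝔸), 0 < α₀ → M * α₀ ≤ a₃ →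
    (bg (mem M i m)).Reg335 c35 α₀ (ιCfg M i m U₀ hU₀) → RegularAt i.η (ops M i m) (i.Ω 0) U₀

/-- ★★★ **THE BINDER `InvAt` FOR THE GENUINE LETTER, FROM THEOREM 3.11 AT THE MEMBER ALONE**: if `Δ_a(U₀)↾Ω₀` is invertible on `E(Ω₀)` at every
unitary `U₀` of the member's class (3.35) (`RegularInClassAt`), then `B9SupplySockB9P3ZdAt.InvAt bg L mem ιCfg (withGopZd ops) c35 a₃ M i m`: for every
`A ∈ E(Ω₀)` (`OnDom`) and every `J` agreeing with `Δ_a(U₀)A` on the bonds of `Ω₀`, `G(U₀)J = A` — (3.27) in the form B8 (1.58) uses it.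
[cite: Balaban1985BackgroundPropagators, (3.27) p.395, Thm 3.11 p.416; Balaban1985RegularSpaces, (1.58) p.86] -/
theorem invAt_withGopZd (c35 a₃ : ℝ) (hreg : RegularInClassAt bg mem ιCfg ops c35 a₃ M i m) :
    InvAt bg L mem ιCfg (withGopZd ops) c35 a₃ M i m := by
  intro α₀ U₀ hU₀ hα hMα hR A hA J hJ
  show gopZd i.η (ops M i m) (i.Ω 0) U₀ J = A
  exact gopZd_apply_eq_of_regularAt i.η (ops M i m) (i.Ω 0) U₀ (hreg α₀ U₀ hU₀ hα hMα hR) (mem_domSub_of_onDom hA) hJ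

end Record

/-! ## §4  Finite `Ω₀`: positivity of the pairing `⟨A, Δ_a(U₀)A⟩_τ` on `E(Ω₀)` gives `RegularAt` (Theorem 3.11 ⟹ (3.27) exists) -/

section Positivity

variable (τ : 𝔸 →ₗ[ℂ] ℂ)

/-- **THE PAIRING OF BOND FIELDS** `⟨A, J⟩_τ = Σ_μ Σᶠ_x Re τ(A(x,μ)* J(x,μ))` (print's `Σ η^d tr A(b)J(b)` with the positive weight dropped; the letter of
`B9Eq326GaugeTermSquareZd`, for a finitely supported `A`). [cite: Balaban1985BackgroundPropagators, (3.17) p.393, p.391 («X·Y = tr XY»)] -/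
def bondPair (A J : Site d → Fin d → 𝔸) : ℝ := ∑ μ : Fin d, ∑ᶠ x, (τ (star (A x μ) * J x μ)).re

/-- `⟨A, 0⟩_τ = 0`. [cite: Balaban1985BackgroundPropagators, (3.17) p.393 (bookkeeping)] -/
theorem bondPair_zero_right (A : Site d → Fin d → 𝔸) : bondPair τ A 0 = 0 := by
  simp only [bondPair, Pi.zero_apply, mul_zero, map_zero, Complex.zero_re, finsum_zero, Finset.sum_const_zero]

/-- **FOR `A ∈ E(Ω₀)` THE PAIRING SEES `J` ONLY ON THE BONDS OF `Ω₀`**: `⟨A, 𝟙_{Ω₀}J⟩_τ = ⟨A, J⟩_τ`.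
[cite: Balaban1985BackgroundPropagators, (3.27) p.395 («Ω₀Δ_aΩ₀»)] -/
theorem bondPair_restrictDom_right {Ω₀ : Set (Site d)} {A : Site d → Fin d → 𝔸} (hA : A ∈ domSub (𝔸 := 𝔸) Ω₀) (J : Site d → Fin d → 𝔸) :
    bondPair τ A (restrictDom Ω₀ J) = bondPair τ A J := by
  simp only [bondPair]
  refine Finset.sum_congr rfl fun μ _ => finsum_congr fun x => ?_
  by_cases hb : BondTouches Ω₀ x μ
  · rw [restrictDom_of J hb]
  · rw [restrictDom_of_not J hb, hA x μ hb, star_zero, zero_mul, zero_mul]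

/-- **«`Δ_a(U₀)` AGREES ON `E(Ω₀)` WITH AN ℝ-LINEAR MAP»** — the linearity of the record's letters at `U₀` as one `Prop` (true for the genuine letters,
each ℝ-linear in `A`; B8's current `D*D` is linear). [cite: Balaban1985BackgroundPropagators, (3.26) p.395 (Δ_a is a linear operator)] -/
def LinearOnDomAt (η : ℝ) (o : OpsZd d 𝔸) (Ω₀ : Set (Site d)) (U₀ : Site d → Fin d → 𝔸ˣ) : Prop :=
  ∃ T : (Site d → Fin d → 𝔸) →ₗ[ℝ] (Site d → Fin d → 𝔸), ∀ A ∈ domSub (𝔸 := 𝔸) Ω₀, T A = deltaAOf η o U₀ A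

/-- ★★ **THEOREM 3.11 ⟹ (3.27) EXISTS, AT THE CARRIER: POSITIVITY GIVES `RegularAt`.**  `Ω₀` finite, `𝔸` finite-dimensional, any `τ`: if `Δ_a(U₀)` is
(the restriction of) an ℝ-linear map on `E(Ω₀)` and `0 < ⟨A, Δ_a(U₀)A⟩_τ` for every `0 ≠ A ∈ E(Ω₀)` («Δ_a, G are positive definite»), then `Δ_a(U₀)↾Ω₀` is
an invertible operator of `E(Ω₀)` — positive ⟹ injective ⟹ (finite dimension) bijective. [cite: Balaban1985BackgroundPropagators, Thm 3.11 p.416, (3.27) p.395] -/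
theorem regularAt_of_bondPair_pos [FiniteDimensional ℝ 𝔸] {η : ℝ} {o : OpsZd d 𝔸} {Ω₀ : Set (Site d)} {U₀ : Site d → Fin d → 𝔸ˣ}
    (hΩ : Ω₀.Finite) (hlin : LinearOnDomAt η o Ω₀ U₀)
    (hpos : ∀ A ∈ domSub (𝔸 := 𝔸) Ω₀, A ≠ 0 → 0 < bondPair τ A (deltaAOf η o U₀ A)) :
    RegularAt η o Ω₀ U₀ := by
  haveI := finiteDimensional_domSub (𝔸 := 𝔸) hΩ
  obtain ⟨T, hT⟩ := hlin
  -- `Φ := 𝟙_{Ω₀} ∘ T` restricted to `E(Ω₀)`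
  let Φ : domSub (𝔸 := 𝔸) Ω₀ →ₗ[ℝ] domSub (𝔸 := 𝔸) Ω₀ := (restrictLin Ω₀).comp (T.domRestrict (domSub Ω₀))
  have hΦ : ∀ A : domSub (𝔸 := 𝔸) Ω₀, (Φ A : Site d → Fin d → 𝔸) = deltaADom η o Ω₀ U₀ A := by
    intro A
    show restrictDom Ω₀ (T A) = restrictDom Ω₀ (deltaAOf η o U₀ A)
    rw [hT A A.2]
  have hinj : Function.Injective Φ := by
    intro A B hAB
    by_contra hne
    have hne' : ((A - B : domSub (𝔸 := 𝔸) Ω₀) : Site d → Fin d → 𝔸) ≠ 0 := by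
      intro h0
      exact hne (sub_eq_zero.1 (Subtype.ext h0))
    have hp := hpos _ (A - B).2 hne'
    have hzero : (Φ (A - B) : Site d → Fin d → 𝔸) = 0 := by rw [map_sub, hAB, sub_self, Submodule.coe_zero]
    rw [← bondPair_restrictDom_right τ (A - B).2, ← deltaADom, ← hΦ, hzero, bondPair_zero_right] at hp
    exact lt_irrefl _ hp
  exact ⟨Φ, hΦ, hinj, LinearMap.injective_iff_surjective.1 hinj⟩

/-- **THE FOUR TERMS OF `⟨A, Δ_a(U₀)A⟩_τ`** for a finitely supported `A`: `⟨A, D*DA⟩ + ⟨A, Δ′A⟩ + ⟨A, DRD*A⟩ + ⟨A, Q*aQA⟩` ((3.26) with (3.10)); the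
first is `≥ 0` at a unitary background (`sum_finsum_re_trace_Jcur_nonneg`), the third for this seat's `opsLandau τ` (`opsLandau_DRDs_form_nonneg`).
[cite: Balaban1985BackgroundPropagators, (3.26) p.395, (3.10) p.392] -/
theorem bondPair_deltaAOf_eq_four_terms (η : ℝ) (o : OpsZd d 𝔸) (U₀ : Site d → Fin d → 𝔸ˣ) {A : Site d → Fin d → 𝔸}
    (hA : ∀ μ : Fin d, (Function.support fun x => A x μ).Finite) :
    bondPair τ A (deltaAOf η o U₀ A) =
      (∑ μ : Fin d, ∑ᶠ x, (τ (star (A x μ) * Jcur η U₀ A μ x)).re) + bondPair τ A (o.Dp U₀ A) +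
        bondPair τ A (o.DRDs U₀ A) + bondPair τ A (o.QQ U₀ A) := by
  simp only [bondPair, ← Finset.sum_add_distrib]
  refine Finset.sum_congr rfl fun μ _ => ?_
  classical
  set S := (hA μ).toFinset with hS
  have hsub : ∀ g : Site d → 𝔸, (Function.support fun x => (τ (star (A x μ) * g x)).re) ⊆ ↑S := by
    intro g x hx
    rw [hS, Set.Finite.coe_toFinset, Function.mem_support]
    intro h0
    rw [Function.mem_support, h0, star_zero, zero_mul, map_zero, Complex.zero_re] at hx
    exact hx rfl
  rw [finsum_eq_sum_of_support_subset (fun x => (τ (star (A x μ) * deltaAOf η o U₀ A x μ)).re)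
      (hsub fun x => deltaAOf η o U₀ A x μ),
    finsum_eq_sum_of_support_subset (fun x => (τ (star (A x μ) * Jcur η U₀ A μ x)).re) (hsub fun x => Jcur η U₀ A μ x),
    finsum_eq_sum_of_support_subset (fun x => (τ (star (A x μ) * o.Dp U₀ A x μ)).re) (hsub fun x => o.Dp U₀ A x μ),
    finsum_eq_sum_of_support_subset (fun x => (τ (star (A x μ) * o.DRDs U₀ A x μ)).re) (hsub fun x => o.DRDs U₀ A x μ),
    finsum_eq_sum_of_support_subset (fun x => (τ (star (A x μ) * o.QQ U₀ A x μ)).re) (hsub fun x => o.QQ U₀ A x μ),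
    ← Finset.sum_add_distrib, ← Finset.sum_add_distrib, ← Finset.sum_add_distrib]
  refine Finset.sum_congr rfl fun x _ => ?_
  simp only [deltaAOf, mul_add, map_add, Complex.add_re]

end Positivity

/-! ## §5  A6 ∕ non-vacuity: the one-level record, where `⟨A, Δ_aA⟩ = ⟨A, D*DA⟩ + η⁻²‖A‖² > 0` at EVERY unitary background -/

section LevelZero

variable {L : ℕ}

/-- **THE ONE-LEVEL RECORD** (A6 inhabitant of the hypothesis class): `ops₀` with `Dp := 0`, `DRDs := 0` and `QQ U₀ A := η⁻²·𝟙_{Ω₀}A` — the `m = 0`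
reading of (3.16) in B8's normalisation `Σ_j (Lʲη)⁻²Q*_jΛ_jQ_j` (one level: `Q₀ = I`, `Λ₀ = Ω₀`).  NOT print's regime at `m ≥ 1` (there `Δ′`, `DRD*`,
`Q*aQ` are the genuine letters of the other record edits); used only to inhabit `RegularAt` ∕ `RegularInClassAt`.
[cite: Balaban1985BackgroundPropagators, (3.16) p.393, (3.26) p.395; Balaban1985RegularSpaces, (1.58) p.86] -/
def opsLevelZero (ops₀ : ℝ → ZdIdx d L → ℕ → OpsZd d 𝔸) : ℝ → ZdIdx d L → ℕ → OpsZd d 𝔸 :=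
  fun M i m =>
    { Gop := (ops₀ M i m).Gop
      Dp := fun _ _ => 0
      DRDs := fun _ _ => 0
      QQ := fun _ A => (i.η ^ 2)⁻¹ • restrictDom (i.Ω 0) A }

variable (ops₀ : ℝ → ZdIdx d L → ℕ → OpsZd d 𝔸) (M : ℝ) (i : ZdIdx d L) (m : ℕ)

/-- `Δ_a` of the one-level record: `D*_{U₀}D_{U₀}A + η⁻²𝟙_{Ω₀}A`. [cite: Balaban1985BackgroundPropagators, (3.26) p.395, (3.16) p.393] -/
theorem deltaAOf_opsLevelZero (U₀ : Site d → Fin d → 𝔸ˣ) (A : Site d → Fin d → 𝔸) (x : Site d) (μ : Fin d) :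
    deltaAOf i.η (opsLevelZero ops₀ M i m) U₀ A x μ = Jcur i.η U₀ A μ x + (i.η ^ 2)⁻¹ • restrictDom (i.Ω 0) A x μ := by
  simp only [deltaAOf, opsLevelZero, Pi.zero_apply, add_zero, Pi.smul_apply]

/-- the plaquette covariant derivative (3.4) is ℂ-homogeneous in the bond field. [cite: Balaban1985BackgroundPropagators, (3.4) p.391] -/
theorem plaqCovDeriv_smul (η : ℝ) (U₀ : Site d → Fin d → 𝔸ˣ) (c : ℂ) (A : Site d → Fin d → 𝔸) (μ ν : Fin d) (x : Site d) :
    plaqCovDeriv η U₀ (c • A) μ ν x = c • plaqCovDeriv η U₀ A μ ν x := by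
  rw [plaqCovDeriv, plaqCovDeriv, show (c • A) = fun y κ => c • A y κ from rfl, B8Eq146AExpansion.lin_smul, smul_comm]

/-- **B8's CURRENT `J = D^{η*}_{U₀}D^η_{U₀}A` IS ℂ-HOMOGENEOUS IN `A`.** [cite: Balaban1985RegularSpaces, (1.55) p.86] -/
theorem Jcur_smul (η : ℝ) (U₀ : Site d → Fin d → 𝔸ˣ) (c : ℂ) (A : Site d → Fin d → 𝔸) (μ : Fin d) (x : Site d) :
    Jcur η U₀ (c • A) μ x = c • Jcur η U₀ A μ x := by
  rw [B8Eq155JBound.Jcur_def, B8Eq155JBound.Jcur_def]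
  have h : plaqCovDeriv η U₀ (c • A) = c • plaqCovDeriv η U₀ A := by
    funext μ' ν' x'
    exact plaqCovDeriv_smul η U₀ c A μ' ν' x'
  rw [h, B8Eq146AExpansion.pdiv_smul]

/-- B8's current is ℝ-homogeneous in `A`. [cite: Balaban1985RegularSpaces, (1.55) p.86] -/
theorem Jcur_smul_real (η : ℝ) (U₀ : Site d → Fin d → 𝔸ˣ) (c : ℝ) (A : Site d → Fin d → 𝔸) (μ : Fin d) (x : Site d) :
    Jcur η U₀ (c • A) μ x = c • Jcur η U₀ A μ x := by
  rw [← Complex.coe_smul, ← Complex.coe_smul c (Jcur η U₀ A μ x)]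
  exact Jcur_smul η U₀ (c : ℂ) A μ x

/-- **`Δ_a(U₀)` OF THE ONE-LEVEL RECORD IS ℝ-LINEAR** (at every background, on all bond fields). [cite: Balaban1985BackgroundPropagators, (3.26) p.395] -/
def deltaALevelZeroLin (η : ℝ) (Ω₀ : Set (Site d)) (U₀ : Site d → Fin d → 𝔸ˣ) :
    (Site d → Fin d → 𝔸) →ₗ[ℝ] (Site d → Fin d → 𝔸) where
  toFun A := fun x μ => Jcur η U₀ A μ x + (η ^ 2)⁻¹ • restrictDom Ω₀ A x μ
  map_add' A B := by
    funext x μ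
    rw [Pi.add_apply, Pi.add_apply, B9SupplySockB9P3ZdLettersOmega.Jcur_add, restrictDom_add', Pi.add_apply, Pi.add_apply, smul_add]
    abel
  map_smul' c A := by
    funext x μ
    rw [RingHom.id_apply, Pi.smul_apply, Pi.smul_apply, Jcur_smul_real, restrictDom_smul', Pi.smul_apply, Pi.smul_apply, smul_add,
      smul_comm c]

/-- `LinearOnDomAt` holds for the one-level record (indeed on all bond fields). [cite: Balaban1985BackgroundPropagators, (3.26) p.395] -/
theorem linearOnDomAt_opsLevelZero (U₀ : Site d → Fin d → 𝔸ˣ) :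
    LinearOnDomAt i.η (opsLevelZero ops₀ M i m) (i.Ω 0) U₀ := by
  refine ⟨deltaALevelZeroLin i.η (i.Ω 0) U₀, fun A _ => ?_⟩
  funext x μ
  rw [deltaAOf_opsLevelZero]
  rfl

/-- each diagonal term `Re τ(a* a)` is non-negative for a faithful positive trace. [folklore] -/
private theorem re_trace_star_mul_self_nonneg (τ : 𝔸 →ₗ[ℂ] ℂ) (hτp : ∀ a : 𝔸, a ≠ 0 → 0 < (τ (star a * a)).re) (a : 𝔸) :
    0 ≤ (τ (star a * a)).re := by
  by_cases ha : a = 0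
  · rw [ha, mul_zero, map_zero, Complex.zero_re]
  · exact (hτp a ha).le

/-- **`‖A‖²_τ = Σ_μ Σᶠ_x Re τ(A(x,μ)* A(x,μ)) > 0` FOR A FINITELY SUPPORTED `A ≠ 0`** and a faithful `τ`. [cite: Balaban1985BackgroundPropagators, p.390 («|X|² = tr X*X»)] -/
theorem bondPair_self_pos (τ : 𝔸 →ₗ[ℂ] ℂ) (hτp : ∀ a : 𝔸, a ≠ 0 → 0 < (τ (star a * a)).re) {A : Site d → Fin d → 𝔸}
    (hA : ∀ μ : Fin d, (Function.support fun x => A x μ).Finite) (hA0 : A ≠ 0) : 0 < bondPair τ A A := by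
  obtain ⟨x₀, hx₀⟩ := Function.ne_iff.1 hA0
  obtain ⟨μ₀, hx⟩ := Function.ne_iff.1 hx₀
  rw [bondPair]
  have hterm : ∀ μ, 0 ≤ ∑ᶠ x, (τ (star (A x μ) * A x μ)).re :=
    fun μ => finsum_nonneg fun x => re_trace_star_mul_self_nonneg τ hτp (A x μ)
  refine lt_of_lt_of_le ?_ (Finset.single_le_sum (fun μ _ => hterm μ) (Finset.mem_univ μ₀))
  have hs : (Function.support fun x => (τ (star (A x μ₀) * A x μ₀)).re) ⊆ (hA μ₀).toFinset := by
    intro x hx'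
    rw [Set.Finite.coe_toFinset, Function.mem_support]
    intro h0
    rw [Function.mem_support, h0, star_zero, zero_mul, map_zero, Complex.zero_re] at hx'
    exact hx' rfl
  rw [finsum_eq_sum_of_support_subset _ hs]
  refine lt_of_lt_of_le (hτp _ hx) (Finset.single_le_sum (fun x _ => re_trace_star_mul_self_nonneg τ hτp (A x μ₀)) ?_)
  rw [Set.Finite.mem_toFinset, Function.mem_support]
  exact hx

/-- a field of `E(Ω₀)` with finite `Ω₀` is finitely supported in every direction. [cite: Balaban1985RegularSpaces, p.77 (bond convention)] -/
theorem support_finite_of_mem_domSub {Ω₀ : Set (Site d)} (hΩ : Ω₀.Finite) {A : Site d → Fin d → 𝔸} (hA : A ∈ domSub (𝔸 := 𝔸) Ω₀)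
    (μ : Fin d) : (Function.support fun x => A x μ).Finite := by
  refine ((setOf_bondTouches_finite hΩ).image Prod.fst).subset fun x hx => ?_
  rw [Function.mem_support] at hx
  refine ⟨(x, μ), ?_, rfl⟩
  by_contra hb
  exact hx (hA x μ hb)

/-- ★ **`⟨A, Δ_a(U₀)A⟩_τ = ⟨A, D*_{U₀}D_{U₀}A⟩_τ + η⁻²‖A‖²_τ > 0` FOR THE ONE-LEVEL RECORD**, for every `0 ≠ A ∈ E(Ω₀)` (finite `Ω₀`), EVERY unitary
background `U₀`, `η ≠ 0`, and a tracial faithful `τ` — the first summand is this seat's energy positivity `sum_finsum_re_trace_Jcur_nonneg` (p591149), the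
second a positive multiple of `‖A‖²_τ`. [cite: Balaban1985BackgroundPropagators, Thm 3.11 p.416 («Δ_a, G are positive definite»), (3.26) p.395] -/
theorem bondPair_deltaAOf_opsLevelZero_pos (τ : 𝔸 →ₗ[ℂ] ℂ) (hτt : ∀ a b : 𝔸, τ (a * b) = τ (b * a))
    (hτp : ∀ a : 𝔸, a ≠ 0 → 0 < (τ (star a * a)).re) (hΩ : (i.Ω 0).Finite)
    {U₀ : Site d → Fin d → 𝔸ˣ} (hU : ∀ (x : Site d) (κ : Fin d), U₀ x κ ∈ unitaryUnits 𝔸)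
    {A : Site d → Fin d → 𝔸} (hA : A ∈ domSub (𝔸 := 𝔸) (i.Ω 0)) (hA0 : A ≠ 0) :
    0 < bondPair τ A (deltaAOf i.η (opsLevelZero ops₀ M i m) U₀ A) := by
  have hfin := support_finite_of_mem_domSub hΩ hA
  rw [bondPair_deltaAOf_eq_four_terms τ i.η (opsLevelZero ops₀ M i m) U₀ hfin]
  have h1 : 0 ≤ ∑ μ : Fin d, ∑ᶠ x, (τ (star (A x μ) * Jcur i.η U₀ A μ x)).re := sum_finsum_re_trace_Jcur_nonneg i.η hτt hτp hU hfin
  have h2 : bondPair τ A ((opsLevelZero ops₀ M i m).Dp U₀ A) = 0 := bondPair_zero_right τ A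
  have h3 : bondPair τ A ((opsLevelZero ops₀ M i m).DRDs U₀ A) = 0 := bondPair_zero_right τ A
  have h4 : bondPair τ A ((opsLevelZero ops₀ M i m).QQ U₀ A) = (i.η ^ 2)⁻¹ * bondPair τ A A := by
    show bondPair τ A ((i.η ^ 2)⁻¹ • restrictDom (i.Ω 0) A) = _
    rw [restrictDom_eq_self_of_mem (i.Ω 0) hA, bondPair, bondPair, Finset.mul_sum]
    refine Finset.sum_congr rfl fun μ _ => ?_
    rw [mul_finsum]
    refine finsum_congr fun x => ?_
    rw [Pi.smul_apply, Pi.smul_apply, mul_smul_comm, ← Complex.coe_smul, map_smul, smul_eq_mul, Complex.re_ofReal_mul]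
  rw [h2, h3, h4, add_zero, add_zero]
  have hη : 0 < (i.η ^ 2)⁻¹ := inv_pos.2 (pow_pos i.hη 2)
  exact add_pos_of_nonneg_of_pos h1 (mul_pos hη (bondPair_self_pos τ hτp hfin hA0))

/-- ★ **A6: `RegularAt` IS INHABITED** — for the one-level record, `Δ_a(U₀)↾Ω₀` is invertible on `E(Ω₀)` at EVERY unitary background (finite `Ω₀`,
finite-dimensional `𝔸` with a faithful tracial `τ`): §4 applied to §5's positivity. [cite: Balaban1985BackgroundPropagators, Thm 3.11 p.416, (3.27) p.395] -/
theorem regularAt_opsLevelZero [FiniteDimensional ℝ 𝔸] (τ : 𝔸 →ₗ[ℂ] ℂ) (hτt : ∀ a b : 𝔸, τ (a * b) = τ (b * a))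
    (hτp : ∀ a : 𝔸, a ≠ 0 → 0 < (τ (star a * a)).re) (hΩ : (i.Ω 0).Finite)
    {U₀ : Site d → Fin d → 𝔸ˣ} (hU : ∀ (x : Site d) (κ : Fin d), U₀ x κ ∈ unitaryUnits 𝔸) :
    RegularAt i.η (opsLevelZero ops₀ M i m) (i.Ω 0) U₀ :=
  regularAt_of_bondPair_pos τ hΩ (linearOnDomAt_opsLevelZero ops₀ M i m U₀)
    fun _ hA hA0 => bondPair_deltaAOf_opsLevelZero_pos ops₀ M i m τ hτt hτp hΩ hU hA hA0

/-- **A6: `RegularInClassAt` IS INHABITED** for the one-level record at every member with finite `Ω₀`, for EVERY frame `bg ∕ mem ∕ ιCfg` and all `c35 a₃ M`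
(the class-(3.35) and smallness guards are not even used). [cite: Balaban1985BackgroundPropagators, Thm 3.11 p.416, (3.27) p.395] -/
theorem regularInClassAt_opsLevelZero [FiniteDimensional ℝ 𝔸] (τ : 𝔸 →ₗ[ℂ] ℂ) (hτt : ∀ a b : 𝔸, τ (a * b) = τ (b * a))
    (hτp : ∀ a : 𝔸, a ≠ 0 → 0 < (τ (star a * a)).re)
    {I : Type} (bg : I → B9.Backgrounds) (mem : ℝ → ZdIdx d L → ℕ → I)
    (ιCfg : ∀ (M : ℝ) (i : ZdIdx d L) (m : ℕ) (U₀ : Site d → Fin d → 𝔸ˣ), (∀ x κ, U₀ x κ ∈ unitaryUnits 𝔸) → (bg (mem M i m)).Cfg)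
    (c35 a₃ : ℝ) (hΩ : (i.Ω 0).Finite) :
    RegularInClassAt bg mem ιCfg (opsLevelZero ops₀) c35 a₃ M i m :=
  fun _ _ hU₀ _ _ _ => regularAt_opsLevelZero ops₀ M i m τ hτt hτp hΩ hU₀

/-- **A6: the conclusion of `invAt_withGopZd` IS INHABITED** — `InvAt bg L mem ιCfg (withGopZd (opsLevelZero ops₀)) c35 a₃ M i m` at every member with
finite `Ω₀`, every frame, all `c35 a₃ M`, under the `τ`-hypotheses only. [cite: Balaban1985BackgroundPropagators, Thm 3.11 p.416, (3.27) p.395] -/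
theorem invAt_withGopZd_opsLevelZero [FiniteDimensional ℝ 𝔸] (τ : 𝔸 →ₗ[ℂ] ℂ) (hτt : ∀ a b : 𝔸, τ (a * b) = τ (b * a))
    (hτp : ∀ a : 𝔸, a ≠ 0 → 0 < (τ (star a * a)).re)
    {I : Type} (bg : I → B9.Backgrounds) (mem : ℝ → ZdIdx d L → ℕ → I)
    (ιCfg : ∀ (M : ℝ) (i : ZdIdx d L) (m : ℕ) (U₀ : Site d → Fin d → 𝔸ˣ), (∀ x κ, U₀ x κ ∈ unitaryUnits 𝔸) → (bg (mem M i m)).Cfg)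
    (c35 a₃ : ℝ) (hΩ : (i.Ω 0).Finite) :
    InvAt bg L mem ιCfg (withGopZd (opsLevelZero ops₀)) c35 a₃ M i m :=
  invAt_withGopZd (opsLevelZero ops₀) M i m bg mem ιCfg c35 a₃ (regularInClassAt_opsLevelZero ops₀ M i m τ hτt hτp bg mem ιCfg c35 a₃ hΩ)

end LevelZero

end Literature.MathematicalPhysics.QuantumFieldTheory.Balaban1983to89.B9Eq327GreenZd

end
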